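import Literature.MathematicalPhysics.QuantumManyBody.BoseGasSubcellCondensationDilute
import HarnessLib

/-!
# Local condensation of Dirichlet near-minimisers into sub-cell constant modes: the sharp floor

Topic `Literature/MathematicalPhysics/QuantumManyBody`, namespace `…BoseGas`; companion of
`BoseGasSubcellCondensation.lean` and `BoseGasSubcellCondensationDilute.lean` (support of the crux
`BECTangentRigidity.TangentTransfer`, stmt-AtomisticToContinuum-13033, of the summit
`AtomisticToContinuum/BoseEinsteinCondensation`).  Those files prove that the `8^k` sub-cell
constant modes of side `L/2^k ∈ [M/√ρ, 2M/√ρ)` carry at least `7N/8` of the particles of every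
`1`-near-minimiser of the Dirichlet energy, for small `ρ` and large `N`
(`seven_eighths_le_sum_occupation`, `floor_of_scatteringLength_pos`).  The threshold `7/8` there is
an artefact of the budget `≤ N/8`; the mechanism (LSSY's localization of energy Lemma 5.2 in every
well-occupied cell, the generalized Poincaré inequality Lemma 4.1 on every sub-cell slice with the
balls around the same-cell particles removed, the cell method with a crowding penalty, and the Dyson
upper bound) gives a depletion budget proportional to
`(s/ξ)² · (relative error of the leading-order energy asymptotics)`, which tends to `0` as `ρ → 0`
at a fixed multiple `s ≤ 2M√(8πa)·ξ` of the healing length.  This file records the sharp form: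

* `natCast_le_sum_occupation_add_budget` — the deterministic floor inequality WITHOUT a budget
  hypothesis: under the hypotheses of `seven_eighths_le_sum_occupation` (minus the budget),
  `N ≤ ∑_q ⟨u_q, γ_Ψ u_q⟩ + (2Cs²(U + B - A) + CwU)`; its corollary
  `sub_le_sum_occupation_of_budget`: a budget `≤ ηN` gives `(1-η)N ≤ ∑_q ⟨u_q, γ_Ψ u_q⟩`;
* `floorBudget_le_of_le` — the budget at the mesoscopic scale is `≤ ηN` as soon as the per-particle
  terms are `≤ η/2` and `2(8CM²/ρ + Cw̄) ≤ ηN`;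
* `floorBudgetSum_eventually_le` — the per-particle terms are `≤ ε` for every `ε > 0` and all
  sufficiently small `ρ` (every term is a positive power of `√ρ` at fixed `a`, `M`);
* `floor_of_scatteringLength_pos_sharp` — positive scattering length: for every `η > 0`, `M > 0`
  and all small `ρ < ρ₀(η, M, v)`, eventually in `N`, every `1`-near-minimiser of the Dirichlet
  energy has `∑_q ⟨u_q, γ_Ψ u_q⟩ ≥ (1-η)N` over the sub-cells of side `L/2^k ∈ [M/√ρ, 2M/√ρ)`.

The proofs are those of the two companion files with the last arithmetic step generalised; no
definitions are introduced.

## References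

* [LSSY2005] E. H. Lieb, R. Seiringer, J. P. Solovej, J. Yngvason, *The Mathematics of the Bose
  Gas and its Condensation*, Oberwolfach Seminars 34, Birkhäuser 2005 (arXiv:cond-mat/0610117):
  Thm. 2.2 (2.14), Thm. 2.4 (2.35) and (2.52)–(2.58), Lemma 4.1 (4.2), Lemma 5.2 (5.7)–(5.14),
  proof of Thm. 5.1 (5.15)–(5.17).
* [LiebSeiringer2002] E. H. Lieb, R. Seiringer, *Proof of Bose–Einstein condensation for dilute
  trapped gases*, Phys. Rev. Lett. 88 (2002) 170409.
-/

noncomputable section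

open MeasureTheory Filter Set Metric
open scoped ENNReal NNReal Topology BigOperators

namespace Literature.MathematicalPhysics.QuantumManyBody.BoseGas

/-! ## The deterministic floor inequality without a budget hypothesis -/

section Main

variable {n K : ℕ} {s L : ℝ}

/-- **The deterministic floor inequality, budget-free form.**  Let `Ψ` be a Dirichlet state of
`Λ_L`, `L = Ks`, with energy `≤ U`.  Classify occupation numbers `m` of cells of side `s` into
`good` ones — for which the localized cell functional is bounded below,
`lb(m) ≤ E'(y(m), R(m); m, s)` with `y(m) ≤ 1/2`, and the excluded volume `(m-1)·(4π/3)R(m)³` has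
`(·)^{2/3} ≤ w` — and the others, for which `lb(m) ≤ E₀^Neu(m, s)`.  Suppose the occupation
bookkeeping `A + κ · #{particles in cells that are not good} ≤ ∑_c lb(n_c) + B` holds for every
distribution of the `N` particles over the `K³` cells and that `2 C s² κ ≥ 1` (`C` the constant of
Lemma 4.1).  Then the depletion of the `K³` sub-cell constant modes is at most the budget:
`N ≤ ∑_q ⟨u_q, γ_Ψ u_q⟩ + (2 C s² (U + B - A) + C w U)` (LSSY's mechanism (5.15)–(5.17) run cell
by cell on a big Dirichlet box, with Lemma 5.2's localized lower bound cell by cell and a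
configuration-dependent excluded volume; the proof of `seven_eighths_le_sum_occupation` verbatim up
to its last step). [folklore] -/
theorem natCast_le_sum_occupation_add_budget (hs : 0 < s) (hK : 0 < K) (hKs : (K : ℝ) * s = L)
    (hL : 0 < L) {v : ℝ → ℝ≥0∞} (hv : Measurable v) (Ψ : TrialState (n + 1) L)
    (good : ℕ → Prop) [DecidablePred good] (Rf yf lb : ℕ → ℝ) {C w Ur A B κ : ℝ}
    (hC : 0 ≤ C) (hw : 0 ≤ w) (hUr : 0 ≤ Ur) (hA : 0 ≤ A) (hB : 0 ≤ B)
    (h41 : ∀ (L : ℝ), 0 < L → ∀ (f : Space → ℂ), ContDiff ℝ 1 f →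
      ∀ (Ω : Set Space), MeasurableSet Ω → Ω ⊆ cell L →
        ∫⁻ x in cell L, (‖f x - ⨍ y in cell L, f y‖₊ : ℝ≥0∞) ^ 2 ≤
          ENNReal.ofReal C *
            (ENNReal.ofReal (L ^ 2) * (∫⁻ x in Ω, gradSqC f x) +
              volume (cell L \ Ω) ^ (2 / 3 : ℝ) * ∫⁻ x in cell L, gradSqC f x))
    (hW : ∀ m : ℕ, good (m + 1) →
      ((m : ℝ≥0∞) * (ENNReal.ofReal (Rf (m + 1)) ^ 3 * ENNReal.ofReal (Real.pi * 4 / 3))) ^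
        (2 / 3 : ℝ) ≤ ENNReal.ofReal w)
    (hy : ∀ m, good m → 0 ≤ yf m ∧ yf m ≤ 1 / 2)
    (hloc : ∀ m, good m → ENNReal.ofReal (lb m) ≤ locGroundStateEnergy (yf m) (Rf m) v m s)
    (hE0 : ∀ m, ¬ good m → ENNReal.ofReal (lb m) ≤ neumannGroundStateEnergy v m s)
    (hcomb : ∀ nv : Fin (K ^ 3) → ℕ, ∑ c, nv c = n + 1 →
      ENNReal.ofReal A + ENNReal.ofReal κ * ∑ c, (if good (nv c) then 0 else (nv c : ℝ≥0∞)) ≤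
        (∑ c, ENNReal.ofReal (lb (nv c))) + ENNReal.ofReal B)
    (hκ : 1 ≤ 2 * C * s ^ 2 * κ) (hE : energy v Ψ ≤ ENNReal.ofReal Ur) (hUBA : A ≤ Ur + B) :
    ((n + 1 : ℕ) : ℝ≥0∞) ≤ (∑ q : SubIdx K, occupation (n + 1) (subMode s q) Ψ.ψ) +
      ENNReal.ofReal (2 * C * s ^ 2 * (Ur + B - A) + C * w * Ur) := by
  have hcont : Continuous Ψ.ψ := Ψ.contDiff.continuous
  -- abbreviations: mass, group energy, outside kinetic energy of a group, per assignment and cell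
  set mass : (Fin (n + 1) → Fin (K ^ 3)) → ℝ≥0∞ := fun σ =>
    ∫⁻ X in cellSet K s σ, (‖Ψ.ψ X‖₊ : ℝ≥0∞) ^ 2 with hmass
  set Egrp : (Fin (n + 1) → Fin (K ^ 3)) → Fin (K ^ 3) → ℝ≥0∞ := fun σ c =>
    ∫⁻ X in cellSet K s σ, kineticOn ((Finset.univ.filter (σ · = c)).orderEmbOfFin rfl) Ψ.ψ X +
      interactionOn ((Finset.univ.filter (σ · = c)).orderEmbOfFin rfl) v X *
        (‖Ψ.ψ X‖₊ : ℝ≥0∞) ^ 2 with hEgrp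
  set fout : (Fin (n + 1) → Fin (K ^ 3)) → Fin (K ^ 3) → Config (n + 1) → ℝ≥0∞ := fun σ c X =>
    ∑ i : Fin (Finset.univ.filter (σ · = c)).card,
      (nearSetOn ((Finset.univ.filter (σ · = c)).orderEmbOfFin rfl).toEmbedding
        (Rf (Finset.univ.filter (σ · = c)).card) i)ᶜ.indicator
        (partialGradSq (((Finset.univ.filter (σ · = c)).orderEmbOfFin rfl) i) Ψ.ψ) X
    with hfout
  have hmfout : ∀ σ c, Measurable (fout σ c) := fun σ c =>
    Finset.measurable_sum _ fun i _ =>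
      (measurable_partialGradSq _ Ψ.ψ).indicator (measurableSet_nearSetOn _ _ i).compl
  set Nbad : (Fin (n + 1) → Fin (K ^ 3)) → ℝ≥0∞ := fun σ =>
    ∑ c, (if good (Finset.univ.filter (σ · = c)).card then 0 else
      ((Finset.univ.filter (σ · = c)).card : ℝ≥0∞)) with hNbad
  set 𝒯 : ℝ≥0∞ := ∑ σ : Fin (n + 1) → Fin (K ^ 3), ∑ c,
    (if good (Finset.univ.filter (σ · = c)).card then ∫⁻ X in cellSet K s σ, fout σ c X else 0)
    with h𝒯
  set 𝒩 : ℝ≥0∞ := ∑ σ : Fin (n + 1) → Fin (K ^ 3), Nbad σ * mass σ with h𝒩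
  have hsum_card : ∀ σ : Fin (n + 1) → Fin (K ^ 3),
      ∑ c, (Finset.univ.filter (σ · = c)).card = n + 1 := fun σ =>
    (Finset.card_eq_sum_card_fiberwise (f := σ) (s := Finset.univ) (t := Finset.univ)
      fun _ _ => Finset.mem_univ _).symm.trans (by simp)
  ----------------------------------------------------------------
  -- Step 1: the depletion identity and the slice bound
  ----------------------------------------------------------------
  have hid := occupation_add_depletion_eq hs hL hKs Ψ
  have hdep := depletion_le_cellSet_sums (N := n + 1) hs hK Ψ.contDiff good Rf h41 hW
  rw [hKs] at hdep
  -- Step 2: fibrewise rewriting of the three particle sums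
  have hout_pt : ∀ (σ : Fin (n + 1) → Fin (K ^ 3)) (X : Config (n + 1)),
      (∑ i : Fin (n + 1), if good (Finset.univ.filter (σ · = σ i)).card then
        {Y : Config (n + 1) | ∀ j, j ≠ i → σ j = σ i →
          Rf (Finset.univ.filter (σ · = σ i)).card ≤ dist (Y i) (Y j)}.indicator
          (partialGradSq i Ψ.ψ) X else 0) =
      ∑ c, (if good (Finset.univ.filter (σ · = c)).card then fout σ c X else 0) := by
    intro σ X
    rw [sum_eq_sum_fiber_orderEmb σ]
    refine Finset.sum_congr rfl fun c _ => ?_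
    rw [hfout, ← sum_ite_const_zero]
    refine Finset.sum_congr rfl fun i _ => ?_
    rw [apply_orderEmbOfFin_eq σ c i]
    by_cases hg : good (Finset.univ.filter (σ · = c)).card
    · simp only [hg, if_true]
      by_cases hX : X ∈ nearSetOn ((Finset.univ.filter (σ · = c)).orderEmbOfFin rfl).toEmbedding
        (Rf (Finset.univ.filter (σ · = c)).card) i
      · rw [Set.indicator_of_notMem (fun h => ((mem_farConfig_iff_not_mem_nearSetOn σ c _ i X).1
          (by rw [apply_orderEmbOfFin_eq σ c i]; exact h)) hX),
          Set.indicator_of_notMem (fun h => (Set.mem_compl_iff _ _).1 h hX)]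
      · rw [Set.indicator_of_mem (show X ∈ _ from by
            have := (mem_farConfig_iff_not_mem_nearSetOn σ c
              (Rf (Finset.univ.filter (σ · = c)).card) i X).2 hX
            rw [apply_orderEmbOfFin_eq σ c i] at this; exact this),
          Set.indicator_of_mem (show X ∈ (nearSetOn _ _ i)ᶜ from hX)]
    · simp only [hg, if_false]
  have hkin_pt : ∀ (σ : Fin (n + 1) → Fin (K ^ 3)) (X : Config (n + 1)),
      (∑ i : Fin (n + 1),
        if good (Finset.univ.filter (σ · = σ i)).card then partialGradSq i Ψ.ψ X else 0) =
      ∑ c, (if good (Finset.univ.filter (σ · = c)).card then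
        kineticOn ((Finset.univ.filter (σ · = c)).orderEmbOfFin rfl) Ψ.ψ X else 0) := by
    intro σ X
    rw [sum_eq_sum_fiber_orderEmb σ]
    refine Finset.sum_congr rfl fun c _ => ?_
    simp only [apply_orderEmbOfFin_eq σ c, sum_ite_const_zero]
    rfl
  have hbad_pt : ∀ (σ : Fin (n + 1) → Fin (K ^ 3)) (X : Config (n + 1)),
      (∑ i : Fin (n + 1), if good (Finset.univ.filter (σ · = σ i)).card then (0 : ℝ≥0∞) else
        (‖Ψ.ψ X‖₊ : ℝ≥0∞) ^ 2) =
      Nbad σ * (‖Ψ.ψ X‖₊ : ℝ≥0∞) ^ 2 := by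
    intro σ X
    rw [sum_eq_sum_fiber_orderEmb σ, hNbad, Finset.sum_mul]
    refine Finset.sum_congr rfl fun c _ => ?_
    simp only [apply_orderEmbOfFin_eq σ c]
    by_cases hg : good (Finset.univ.filter (σ · = c)).card
    · simp [hg]
    · simp [hg]
  simp only [hout_pt, hkin_pt, hbad_pt] at hdep
  ----------------------------------------------------------------
  -- Step 3: identify the three terms of the slice bound
  ----------------------------------------------------------------
  have hT_eq : ∀ σ : Fin (n + 1) → Fin (K ^ 3),
      ∫⁻ X in cellSet K s σ,
          ∑ c, (if good (Finset.univ.filter (σ · = c)).card then fout σ c X else 0) =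
        ∑ c, (if good (Finset.univ.filter (σ · = c)).card then
          ∫⁻ X in cellSet K s σ, fout σ c X else 0) := by
    intro σ
    rw [lintegral_finsetSum _ fun c _ => measurable_ite_const _ (hmfout σ c) measurable_const]
    exact Finset.sum_congr rfl fun c _ => lintegral_ite_const_zero _ _ _
  have hN_eq : ∀ σ : Fin (n + 1) → Fin (K ^ 3),
      ∫⁻ X in cellSet K s σ, Nbad σ * (‖Ψ.ψ X‖₊ : ℝ≥0∞) ^ 2 = Nbad σ * mass σ := fun σ =>
    lintegral_const_mul _ (measurable_normSq hcont)
  have hEgrp_m : ∀ (σ : Fin (n + 1) → Fin (K ^ 3)) (c : Fin (K ^ 3)), Measurable fun X =>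
      kineticOn ((Finset.univ.filter (σ · = c)).orderEmbOfFin rfl) Ψ.ψ X +
        interactionOn ((Finset.univ.filter (σ · = c)).orderEmbOfFin rfl) v X *
          (‖Ψ.ψ X‖₊ : ℝ≥0∞) ^ 2 := fun σ c =>
    (measurable_kineticOn _ Ψ.contDiff).add ((measurable_interactionOn _ hv).mul
      (measurable_normSq hcont))
  have hEsum : ∑ σ : Fin (n + 1) → Fin (K ^ 3), ∑ c, Egrp σ c ≤ ENNReal.ofReal Ur :=
    (sum_sum_groupEnergy_le_energy hs hv Ψ).trans hE
  have hK_le : ∑ σ : Fin (n + 1) → Fin (K ^ 3), ∫⁻ X in cellSet K s σ,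
      ∑ c, (if good (Finset.univ.filter (σ · = c)).card then
        kineticOn ((Finset.univ.filter (σ · = c)).orderEmbOfFin rfl) Ψ.ψ X else 0) ≤
        ENNReal.ofReal Ur := by
    refine le_trans (Finset.sum_le_sum fun σ _ => ?_) hEsum
    rw [hEgrp, ← lintegral_finsetSum _ fun c _ => hEgrp_m σ c]
    refine lintegral_mono fun X => Finset.sum_le_sum fun c _ => ?_
    by_cases hg : good (Finset.univ.filter (σ · = c)).card
    · simp only [hg, if_true]; exact le_self_add
    · simp only [hg, if_false]; exact bot_le
  simp only [hT_eq, hN_eq] at hdep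
  -- now: hdep : D ≤ C (s² 𝒯 + w 𝒦') + 𝒩
  ----------------------------------------------------------------
  -- Step 4: energy bookkeeping per group
  ----------------------------------------------------------------
  have hgrp : ∀ (σ : Fin (n + 1) → Fin (K ^ 3)) (c : Fin (K ^ 3)),
      ENNReal.ofReal (lb (Finset.univ.filter (σ · = c)).card) * mass σ +
        ENNReal.ofReal (1 / 2) * (if good (Finset.univ.filter (σ · = c)).card then
          ∫⁻ X in cellSet K s σ, fout σ c X else 0) ≤ Egrp σ c := by
    intro σ c
    by_cases hg : good (Finset.univ.filter (σ · = c)).card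
    · obtain ⟨hy0, hy1⟩ := hy _ hg
      have h := locGroundStateEnergy_mul_add_outside_le σ c hy0 (by linarith)
        (Rf (Finset.univ.filter (σ · = c)).card) hv Ψ.contDiff (K := K) (s := s)
      simp only [hg, if_true]
      refine le_trans (add_le_add (mul_le_mul_left (hloc _ hg) _)
        (mul_le_mul_left (ENNReal.ofReal_le_ofReal (by linarith)) _)) h
    · simp only [hg, if_false, mul_zero, add_zero]
      exact le_trans (mul_le_mul_left (hE0 _ hg) _)
        (neumannGroundStateEnergy_mul_le_cellSet σ c hv Ψ.contDiff)
  set Λ : ℝ≥0∞ := ∑ σ : Fin (n + 1) → Fin (K ^ 3),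
    (∑ c, ENNReal.ofReal (lb (Finset.univ.filter (σ · = c)).card)) * mass σ with hΛ
  have h4 : Λ + ENNReal.ofReal (1 / 2) * 𝒯 ≤ ENNReal.ofReal Ur := by
    refine le_trans (le_of_eq ?_) ((Finset.sum_le_sum fun σ _ => Finset.sum_le_sum fun c _ =>
      hgrp σ c).trans hEsum)
    rw [hΛ, h𝒯, Finset.mul_sum, ← Finset.sum_add_distrib]
    refine Finset.sum_congr rfl fun σ _ => ?_
    rw [Finset.sum_mul, Finset.mul_sum, ← Finset.sum_add_distrib]
  have h4c : ENNReal.ofReal A + ENNReal.ofReal κ * 𝒩 ≤ Λ + ENNReal.ofReal B := by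
    have hmass1 : ∑ σ : Fin (n + 1) → Fin (K ^ 3), mass σ = 1 :=
      sum_mass_cellSet_eq_one hs hK hKs Ψ
    have hσ : ∀ σ : Fin (n + 1) → Fin (K ^ 3),
        (ENNReal.ofReal A + ENNReal.ofReal κ * Nbad σ) * mass σ ≤
          ((∑ c, ENNReal.ofReal (lb (Finset.univ.filter (σ · = c)).card)) + ENNReal.ofReal B) *
            mass σ := fun σ =>
      mul_le_mul_left (hcomb (fun c => (Finset.univ.filter (σ · = c)).card) (hsum_card σ)) _
    have := Finset.sum_le_sum fun σ (_ : σ ∈ Finset.univ) => hσ σ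
    calc ENNReal.ofReal A + ENNReal.ofReal κ * 𝒩
        = ∑ σ : Fin (n + 1) → Fin (K ^ 3),
            (ENNReal.ofReal A + ENNReal.ofReal κ * Nbad σ) * mass σ := by
          rw [h𝒩, Finset.mul_sum]
          simp only [add_mul, Finset.sum_add_distrib, ← Finset.mul_sum, hmass1, mul_one,
            mul_assoc]
      _ ≤ ∑ σ : Fin (n + 1) → Fin (K ^ 3),
          ((∑ c, ENNReal.ofReal (lb (Finset.univ.filter (σ · = c)).card)) + ENNReal.ofReal B) *
            mass σ := this
      _ = Λ + ENNReal.ofReal B := by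
          rw [hΛ]
          simp only [add_mul, Finset.sum_add_distrib, ← Finset.mul_sum, hmass1, mul_one]
  have h4d : ENNReal.ofReal A + (ENNReal.ofReal κ * 𝒩 + ENNReal.ofReal (1 / 2) * 𝒯) ≤
      ENNReal.ofReal (Ur + B) := by
    calc ENNReal.ofReal A + (ENNReal.ofReal κ * 𝒩 + ENNReal.ofReal (1 / 2) * 𝒯)
        = (ENNReal.ofReal A + ENNReal.ofReal κ * 𝒩) + ENNReal.ofReal (1 / 2) * 𝒯 := by ring1
      _ ≤ (Λ + ENNReal.ofReal B) + ENNReal.ofReal (1 / 2) * 𝒯 := add_le_add h4c le_rfl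
      _ = (Λ + ENNReal.ofReal (1 / 2) * 𝒯) + ENNReal.ofReal B := by ring1
      _ ≤ ENNReal.ofReal Ur + ENNReal.ofReal B := add_le_add h4 le_rfl
      _ = ENNReal.ofReal (Ur + B) := (ENNReal.ofReal_add hUr hB).symm
  ----------------------------------------------------------------
  -- Step 5: the depletion is at most the budget `2Cs²(U + B - A) + CwU`
  ----------------------------------------------------------------
  have hX : ENNReal.ofReal κ * 𝒩 + ENNReal.ofReal (1 / 2) * 𝒯 ≤ ENNReal.ofReal (Ur + B - A) := by
    rw [ENNReal.ofReal_sub _ hA]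
    exact ENNReal.le_sub_of_add_le_left ENNReal.ofReal_ne_top h4d
  have hCs : 0 ≤ 2 * C * s ^ 2 := by positivity
  have hD : ∑ i : Fin (n + 1), (ENNReal.ofReal L ^ 3)⁻¹ * ∫⁻ X in cellN (n + 1) L,
      ∑ q : SubIdx K, ∫⁻ x in subCell s q, (‖Ψ.ψ (Function.update X i x) -
        ⨍ y in subCell s q, Ψ.ψ (Function.update X i y)‖₊ : ℝ≥0∞) ^ 2 ≤
      ENNReal.ofReal (2 * C * s ^ 2 * (Ur + B - A) + C * w * Ur) := by
    refine hdep.trans ?_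
    have h1 : ENNReal.ofReal C * (ENNReal.ofReal (s ^ 2) * 𝒯 + ENNReal.ofReal w *
        ∑ σ : Fin (n + 1) → Fin (K ^ 3), ∫⁻ X in cellSet K s σ, ∑ c,
          (if good (Finset.univ.filter (σ · = c)).card then
            kineticOn ((Finset.univ.filter (σ · = c)).orderEmbOfFin rfl) Ψ.ψ X else 0)) ≤
        ENNReal.ofReal (2 * C * s ^ 2) * (ENNReal.ofReal (1 / 2) * 𝒯) +
          ENNReal.ofReal (C * w * Ur) := by
      calc _ ≤ ENNReal.ofReal C *
            (ENNReal.ofReal (s ^ 2) * 𝒯 + ENNReal.ofReal w * ENNReal.ofReal Ur) := by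
            gcongr
        _ = _ := by
            rw [mul_add, ← mul_assoc, ← mul_assoc, ← mul_assoc, ← ENNReal.ofReal_mul hC,
              ← ENNReal.ofReal_mul hCs, ← ENNReal.ofReal_mul hC,
              ← ENNReal.ofReal_mul (by positivity)]
            congr 2; congr 1; ring
    have h2 : 𝒩 ≤ ENNReal.ofReal (2 * C * s ^ 2) * (ENNReal.ofReal κ * 𝒩) := by
      rw [← mul_assoc, ← ENNReal.ofReal_mul hCs]
      exact le_mul_of_one_le_left bot_le (ENNReal.one_le_ofReal.2 hκ)
    calc _ ≤ ENNReal.ofReal (2 * C * s ^ 2) * (ENNReal.ofReal (1 / 2) * 𝒯) +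
          ENNReal.ofReal (C * w * Ur) + ENNReal.ofReal (2 * C * s ^ 2) * (ENNReal.ofReal κ * 𝒩) :=
          add_le_add h1 h2
      _ = ENNReal.ofReal (2 * C * s ^ 2) * (ENNReal.ofReal κ * 𝒩 + ENNReal.ofReal (1 / 2) * 𝒯) +
          ENNReal.ofReal (C * w * Ur) := by ring1
      _ ≤ ENNReal.ofReal (2 * C * s ^ 2) * ENNReal.ofReal (Ur + B - A) +
          ENNReal.ofReal (C * w * Ur) := by gcongr
      _ = ENNReal.ofReal (2 * C * s ^ 2 * (Ur + B - A) + C * w * Ur) := by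
          rw [← ENNReal.ofReal_mul hCs, ← ENNReal.ofReal_add (by nlinarith) (by positivity)]
  ----------------------------------------------------------------
  -- Step 6: conclude from the identity
  ----------------------------------------------------------------
  rw [← hid]
  exact add_le_add le_rfl hD

/-- **The deterministic floor inequality with an arbitrary budget fraction.**  Under the hypotheses
of `natCast_le_sum_occupation_add_budget`, if the budget satisfies
`2 C s² (U + B - A) + C w U ≤ η N` (`η ≥ 0`), then the `K³` sub-cell constant modes carry at least
`(1-η)N` particles: `(1-η)N ≤ ∑_q ⟨u_q, γ_Ψ u_q⟩` (`seven_eighths_le_sum_occupation` is the case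
`η = 1/8`). [folklore] -/
theorem sub_le_sum_occupation_of_budget (hs : 0 < s) (hK : 0 < K) (hKs : (K : ℝ) * s = L)
    (hL : 0 < L) {v : ℝ → ℝ≥0∞} (hv : Measurable v) (Ψ : TrialState (n + 1) L)
    (good : ℕ → Prop) [DecidablePred good] (Rf yf lb : ℕ → ℝ) {C w Ur A B κ η : ℝ}
    (hC : 0 ≤ C) (hw : 0 ≤ w) (hUr : 0 ≤ Ur) (hA : 0 ≤ A) (hB : 0 ≤ B) (hη : 0 ≤ η)
    (h41 : ∀ (L : ℝ), 0 < L → ∀ (f : Space → ℂ), ContDiff ℝ 1 f →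
      ∀ (Ω : Set Space), MeasurableSet Ω → Ω ⊆ cell L →
        ∫⁻ x in cell L, (‖f x - ⨍ y in cell L, f y‖₊ : ℝ≥0∞) ^ 2 ≤
          ENNReal.ofReal C *
            (ENNReal.ofReal (L ^ 2) * (∫⁻ x in Ω, gradSqC f x) +
              volume (cell L \ Ω) ^ (2 / 3 : ℝ) * ∫⁻ x in cell L, gradSqC f x))
    (hW : ∀ m : ℕ, good (m + 1) →
      ((m : ℝ≥0∞) * (ENNReal.ofReal (Rf (m + 1)) ^ 3 * ENNReal.ofReal (Real.pi * 4 / 3))) ^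
        (2 / 3 : ℝ) ≤ ENNReal.ofReal w)
    (hy : ∀ m, good m → 0 ≤ yf m ∧ yf m ≤ 1 / 2)
    (hloc : ∀ m, good m → ENNReal.ofReal (lb m) ≤ locGroundStateEnergy (yf m) (Rf m) v m s)
    (hE0 : ∀ m, ¬ good m → ENNReal.ofReal (lb m) ≤ neumannGroundStateEnergy v m s)
    (hcomb : ∀ nv : Fin (K ^ 3) → ℕ, ∑ c, nv c = n + 1 →
      ENNReal.ofReal A + ENNReal.ofReal κ * ∑ c, (if good (nv c) then 0 else (nv c : ℝ≥0∞)) ≤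
        (∑ c, ENNReal.ofReal (lb (nv c))) + ENNReal.ofReal B)
    (hκ : 1 ≤ 2 * C * s ^ 2 * κ) (hE : energy v Ψ ≤ ENNReal.ofReal Ur) (hUBA : A ≤ Ur + B)
    (hbudget : 2 * C * s ^ 2 * (Ur + B - A) + C * w * Ur ≤ η * (n + 1)) :
    ENNReal.ofReal ((1 - η) * (n + 1)) ≤ ∑ q : SubIdx K, occupation (n + 1) (subMode s q) Ψ.ψ := by
  have h := natCast_le_sum_occupation_add_budget hs hK hKs hL hv Ψ good Rf yf lb hC hw hUr hA hB
    h41 hW hy hloc hE0 hcomb hκ hE hUBA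
  rcases le_or_gt 1 η with hη1 | hη1
  · rw [ENNReal.ofReal_of_nonpos (mul_nonpos_of_nonpos_of_nonneg (by linarith) (by positivity))]
    exact bot_le
  have hsplit : ((n + 1 : ℕ) : ℝ≥0∞) =
      ENNReal.ofReal ((1 - η) * (n + 1)) + ENNReal.ofReal (η * (n + 1)) := by
    rw [← ENNReal.ofReal_add (mul_nonneg (by linarith) (by positivity)) (by positivity),
      ← ENNReal.ofReal_natCast]
    congr 1; push_cast; ring1
  have hfin : ENNReal.ofReal ((1 - η) * (n + 1)) + ENNReal.ofReal (η * (n + 1)) ≤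
      (∑ q : SubIdx K, occupation (n + 1) (subMode s q) Ψ.ψ) + ENNReal.ofReal (η * (n + 1)) := by
    rw [← hsplit]
    exact h.trans (add_le_add le_rfl (ENNReal.ofReal_le_ofReal hbudget))
  exact (ENNReal.add_le_add_iff_right ENNReal.ofReal_ne_top).1 hfin

end Main


/-! ## The budget at the mesoscopic scale, with an arbitrary fraction -/

/-- **The budget of the floor inequality at the mesoscopic scale, sharp form.**  With
`U = 4πρa(1 + C_u(ρa³)^{1/3})N + 1`, `A = (1-θ)(4πa/s³)N²/K`,
`B = K·lam·((1-θ)(8πa/s³)(N/K) + 1/(2Cs²))`, `N/K = ρs³` and `M/√ρ ≤ s ≤ 2M/√ρ`, the quantity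
`2Cs²(U + B - A) + CwU` is at most `ηN` as soon as the per-particle terms are `≤ η/2` and
`2(8CM²/ρ + C w̄) ≤ ηN` (`floorBudget_le` is the case `η = 1/8`). [folklore] -/
theorem floorBudget_le_of_le {a C Cu M ρ s lam lambar w wbar θ θbar N K η : ℝ} (hM : 0 < M)
    (ha : 0 < a) (hC : 0 < C) (hCu : 0 ≤ Cu) (hρ : 0 < ρ) (hsl : M / Real.sqrt ρ ≤ s)
    (hsu : s ≤ 2 * M / Real.sqrt ρ) (hθ0 : 0 ≤ θ) (hθ : θ ≤ θbar)
    (hlam0 : 0 ≤ lam) (hlam : lam ≤ lambar) (hw0 : 0 ≤ w) (hw : w ≤ wbar) (hN0 : 0 ≤ N)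
    (hK : 0 < K) (hKN : N / K = ρ * s ^ 3) (ht1 : Cu * (ρ * a ^ 3) ^ ((1 : ℝ) / 3) ≤ 1)
    (hpar : 32 * Real.pi * C * M ^ 2 * a * (Cu * (ρ * a ^ 3) ^ ((1 : ℝ) / 3) + θbar) +
      16 * Real.pi * C * a * lambar * Real.sqrt ρ / M + lambar * Real.sqrt ρ / M ^ 3 +
        8 * Real.pi * C * a * ρ * wbar ≤ η / 2)
    (hN : 2 * (8 * C * M ^ 2 / ρ + C * wbar) ≤ η * N) :
    2 * C * s ^ 2 * ((4 * Real.pi * ρ * a * (1 + Cu * (ρ * a ^ 3) ^ ((1 : ℝ) / 3)) * N + 1) +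
        K * lam * ((1 - θ) * (8 * Real.pi * a / s ^ 3) * (N / K) + 1 / (2 * C * s ^ 2)) -
          (1 - θ) * (4 * Real.pi * a / s ^ 3) * N ^ 2 / K) +
      C * w * (4 * Real.pi * ρ * a * (1 + Cu * (ρ * a ^ 3) ^ ((1 : ℝ) / 3)) * N + 1) ≤ η * N := by
  have hsr : 0 < Real.sqrt ρ := Real.sqrt_pos.2 hρ
  have hs : 0 < s := lt_of_lt_of_le (by positivity) hsl
  set t : ℝ := Cu * (ρ * a ^ 3) ^ ((1 : ℝ) / 3) with ht
  have ht0 : 0 ≤ t := by positivity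
  -- `K = N/(ρ s³)` bookkeeping
  have hKeq : K * (ρ * s ^ 3) = N := by
    field_simp at hKN; linarith [hKN]
  have hA : (1 - θ) * (4 * Real.pi * a / s ^ 3) * N ^ 2 / K = (1 - θ) * 4 * Real.pi * a * ρ * N := by
    have h1 : N ^ 2 / K = N * (N / K) := by rw [pow_two, mul_div_assoc]
    rw [mul_div_assoc, h1, hKN]
    field_simp
  have hB : K * lam * ((1 - θ) * (8 * Real.pi * a / s ^ 3) * (N / K) + 1 / (2 * C * s ^ 2)) =
      N * lam * ((1 - θ) * 8 * Real.pi * a) / s ^ 3 + N * lam / (2 * C * ρ * s ^ 5) := by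
    have hKinv : K = N / (ρ * s ^ 3) := by field_simp; linarith [hKeq]
    rw [hKN, hKinv]
    field_simp
  -- the scale bounds
  have hlb : 0 ≤ lambar := hlam0.trans hlam
  have hwbar : 0 ≤ wbar := hw0.trans hw
  have hs2 := sq_le_of_scale hρ hsu hs
  have hs1 := inv_le_of_scale hM hρ hsl
  have hs3 := inv_cube_le_of_scale hM hρ hsl
  -- term by term
  have hT1 : 2 * C * s ^ 2 * (4 * Real.pi * ρ * a * (1 + t) * N - (1 - θ) * 4 * Real.pi * a * ρ * N) ≤
      N * (32 * Real.pi * C * M ^ 2 * a * (t + θbar)) := by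
    have h1 : 4 * Real.pi * ρ * a * (1 + t) * N - (1 - θ) * 4 * Real.pi * a * ρ * N =
        4 * Real.pi * a * N * (t + θ) * ρ := by ring
    rw [h1]
    have h2 : 2 * C * s ^ 2 * (4 * Real.pi * a * N * (t + θ) * ρ) =
        8 * Real.pi * C * a * N * (t + θ) * (ρ * s ^ 2) := by ring
    rw [h2]
    have hρs : ρ * s ^ 2 ≤ 4 * M ^ 2 := by
      have := mul_le_mul_of_nonneg_left hs2 hρ.le
      rwa [mul_div_cancel₀ _ hρ.ne'] at this
    have h3 : t + θ ≤ t + θbar := by linarith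
    have hθb : 0 ≤ t + θbar := by linarith
    calc 8 * Real.pi * C * a * N * (t + θ) * (ρ * s ^ 2)
        ≤ 8 * Real.pi * C * a * N * (t + θbar) * (4 * M ^ 2) := by gcongr
      _ = N * (32 * Real.pi * C * M ^ 2 * a * (t + θbar)) := by ring
  have hT2 : 2 * C * s ^ 2 * 1 ≤ 8 * C * M ^ 2 / ρ := by
    rw [mul_one]
    calc 2 * C * s ^ 2 ≤ 2 * C * (4 * M ^ 2 / ρ) := by gcongr
      _ = 8 * C * M ^ 2 / ρ := by ring
  have hT3 : 2 * C * s ^ 2 * (N * lam * ((1 - θ) * 8 * Real.pi * a) / s ^ 3) ≤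
      N * (16 * Real.pi * C * a * lambar * Real.sqrt ρ / M) := by
    have h1 : 2 * C * s ^ 2 * (N * lam * ((1 - θ) * 8 * Real.pi * a) / s ^ 3) =
        16 * Real.pi * C * a * N * ((1 - θ) * lam) * (1 / s) := by
      field_simp
      ring
    rw [h1]
    have h2 : (1 - θ) * lam ≤ lambar := by nlinarith
    calc 16 * Real.pi * C * a * N * ((1 - θ) * lam) * (1 / s)
        ≤ 16 * Real.pi * C * a * N * lambar * (Real.sqrt ρ / M) := by
          gcongr
      _ = N * (16 * Real.pi * C * a * lambar * Real.sqrt ρ / M) := by ring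
  have hT4 : 2 * C * s ^ 2 * (N * lam / (2 * C * ρ * s ^ 5)) ≤ N * (lambar * Real.sqrt ρ / M ^ 3) := by
    have h1 : 2 * C * s ^ 2 * (N * lam / (2 * C * ρ * s ^ 5)) = N * lam / ρ * (1 / s ^ 3) := by
      field_simp
    rw [h1]
    calc N * lam / ρ * (1 / s ^ 3) ≤ N * lambar / ρ * (ρ * Real.sqrt ρ / M ^ 3) := by gcongr
      _ = N * (lambar * Real.sqrt ρ / M ^ 3) := by field_simp
  have hT5 : C * w * (4 * Real.pi * ρ * a * (1 + t) * N + 1) ≤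
      N * (8 * Real.pi * C * a * ρ * wbar) + C * wbar := by
    have h1 : 1 + t ≤ 2 := by linarith
    calc C * w * (4 * Real.pi * ρ * a * (1 + t) * N + 1)
        ≤ C * wbar * (4 * Real.pi * ρ * a * 2 * N + 1) := by gcongr
      _ = N * (8 * Real.pi * C * a * ρ * wbar) + C * wbar := by ring
  -- assemble
  have htot : N * (32 * Real.pi * C * M ^ 2 * a * (t + θbar)) + 8 * C * M ^ 2 / ρ +
      N * (16 * Real.pi * C * a * lambar * Real.sqrt ρ / M) + N * (lambar * Real.sqrt ρ / M ^ 3) +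
      (N * (8 * Real.pi * C * a * ρ * wbar) + C * wbar) ≤ η * N := by
    have h1 : N * (32 * Real.pi * C * M ^ 2 * a * (t + θbar)) +
        N * (16 * Real.pi * C * a * lambar * Real.sqrt ρ / M) + N * (lambar * Real.sqrt ρ / M ^ 3) +
        N * (8 * Real.pi * C * a * ρ * wbar) ≤ N * (η / 2) := by
      calc N * (32 * Real.pi * C * M ^ 2 * a * (t + θbar)) +
            N * (16 * Real.pi * C * a * lambar * Real.sqrt ρ / M) + N * (lambar * Real.sqrt ρ / M ^ 3) +
            N * (8 * Real.pi * C * a * ρ * wbar)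
          = N * (32 * Real.pi * C * M ^ 2 * a * (t + θbar) +
              16 * Real.pi * C * a * lambar * Real.sqrt ρ / M + lambar * Real.sqrt ρ / M ^ 3 +
              8 * Real.pi * C * a * ρ * wbar) := by ring
        _ ≤ N * (η / 2) := mul_le_mul_of_nonneg_left hpar hN0
    have h2 : 8 * C * M ^ 2 / ρ + C * wbar ≤ η * N / 2 := by linarith
    linarith
  calc _ = 2 * C * s ^ 2 * (4 * Real.pi * ρ * a * (1 + t) * N - (1 - θ) * 4 * Real.pi * a * ρ * N) +
        2 * C * s ^ 2 * 1 + 2 * C * s ^ 2 * (N * lam * ((1 - θ) * 8 * Real.pi * a) / s ^ 3) +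
        2 * C * s ^ 2 * (N * lam / (2 * C * ρ * s ^ 5)) +
        C * w * (4 * Real.pi * ρ * a * (1 + t) * N + 1) := by rw [hA, hB]; ring
    _ ≤ _ := by linarith [hT1, hT2, hT3, hT4, hT5, htot]


/-! ## Smallness of the per-particle budget in the dilute limit -/

section Dilute

/-- **The per-particle budget terms are eventually below any `ε > 0`.**  For fixed positive
scattering length `a` and scale factor `M` (and any constants `C₁`, `C₄`, `C_u`), the sum of the
per-particle terms of the floor budget — `32πC₄M²a(C_u(ρa³)^{1/3} + C₁Y_max^{1/17})`,
`16πC₄a·λ̄√ρ/M`, `λ̄√ρ/M³`, `8πC₄aρw̄` — is `≤ ε` for all sufficiently small `ρ`: each is a constant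
times a positive power of `√ρ` (the computation of `floorParams_eventually`, with the target `1/16`
replaced by `ε`). [folklore] -/
theorem floorBudgetSum_eventually_le {a M C₁ C₄ Cu ε : ℝ} (ha : 0 < a) (hM : 0 < M)
    (hε : 0 < ε) :
    ∃ ρ₀ : ℝ, 0 < ρ₀ ∧ ∀ ρ : ℝ, 0 < ρ → ρ < ρ₀ →
      32 * Real.pi * C₄ * M ^ 2 * a * (Cu * (ρ * a ^ 3) ^ ((1 : ℝ) / 3) +
          C₁ * (8 * Real.pi * a ^ 3 * Real.sqrt ρ / (3 * M ^ 3)) ^ ((1 : ℝ) / 17)) +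
        16 * Real.pi * C₄ * a * (6 * M ^ 3 / (Real.pi * a ^ 3 * (ρ * Real.sqrt ρ))) ^ ((1 : ℝ) / 18) *
          Real.sqrt ρ / M +
        (6 * M ^ 3 / (Real.pi * a ^ 3 * (ρ * Real.sqrt ρ))) ^ ((1 : ℝ) / 18) * Real.sqrt ρ / M ^ 3 +
        8 * Real.pi * C₄ * a * ρ *
          ((Real.pi * 4 / 3) * a ^ 3 *
            (Real.pi * a ^ 3 * (ρ * Real.sqrt ρ) / (6 * M ^ 3)) ^ (-(15 : ℝ) / 17) *
              (2 / ρ) ^ ((2 : ℝ) / 17)) ^ ((2 : ℝ) / 3) ≤ ε := by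
  -- the basic small quantities, as functions of `ρ`
  set Ymax : ℝ → ℝ := fun ρ => 8 * Real.pi * a ^ 3 * Real.sqrt ρ / (3 * M ^ 3) with hYmax
  set c18 : ℝ := (6 * M ^ 3 / (Real.pi * a ^ 3)) ^ ((1 : ℝ) / 18) with hc18
  set cw : ℝ := ((Real.pi * 4 / 3) * a ^ 3 * (Real.pi * a ^ 3 / (6 * M ^ 3)) ^ (-(15 : ℝ) / 17) *
    (2 : ℝ) ^ ((2 : ℝ) / 17)) ^ ((2 : ℝ) / 3) with hcw
  -- (1) `Ymax → 0`, `Ymax^{1/17} → 0`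
  have hY : Tendsto Ymax (𝓝[>] 0) (𝓝 0) :=
    tendsto_zero_of_eq_const_mul_sqrt_rpow (8 * Real.pi * a ^ 3 / (3 * M ^ 3)) one_pos
      (fun ρ _ => by rw [hYmax]; simp only [Real.rpow_one]; ring)
  have hY17 : Tendsto (fun ρ => Ymax ρ ^ ((1 : ℝ) / 17)) (𝓝[>] 0) (𝓝 0) := by
    have := (Real.continuousAt_rpow_const 0 ((1 : ℝ) / 17) (Or.inr (by norm_num))).tendsto
    simp only [Real.zero_rpow (by norm_num : ((1 : ℝ) / 17) ≠ 0)] at this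
    exact this.comp hY
  -- (2) `(ρa³)^{1/3} → 0`
  have ht3 : Tendsto (fun ρ : ℝ => (ρ * a ^ 3) ^ ((1 : ℝ) / 3)) (𝓝[>] 0) (𝓝 0) := by
    have hc : Continuous fun ρ : ℝ => (ρ * a ^ 3) ^ ((1 : ℝ) / 3) :=
      (continuous_id.mul continuous_const).rpow_const fun _ => Or.inr (by norm_num)
    have := hc.tendsto 0
    simp only [zero_mul, Real.zero_rpow (by norm_num : ((1 : ℝ) / 3) ≠ 0)] at this
    exact this.mono_left nhdsWithin_le_nhds
  -- (3) `lambar √ρ = c18 (√ρ)^{5/6}`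
  have hlam : ∀ ρ : ℝ, 0 < ρ →
      (6 * M ^ 3 / (Real.pi * a ^ 3 * (ρ * Real.sqrt ρ))) ^ ((1 : ℝ) / 18) * Real.sqrt ρ =
        c18 * Real.sqrt ρ ^ ((5 : ℝ) / 6) := by
    intro ρ hρ
    have ht : 0 < Real.sqrt ρ := Real.sqrt_pos.2 hρ
    have hρt : ρ * Real.sqrt ρ = Real.sqrt ρ ^ (3 : ℝ) := by
      rw [show (3 : ℝ) = 2 + 1 by norm_num, Real.rpow_add ht, Real.rpow_two, Real.sq_sqrt hρ.le,
        Real.rpow_one]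
    have h1 : 6 * M ^ 3 / (Real.pi * a ^ 3 * (ρ * Real.sqrt ρ)) =
        (6 * M ^ 3 / (Real.pi * a ^ 3)) * Real.sqrt ρ ^ (-(3 : ℝ)) := by
      rw [hρt, Real.rpow_neg ht.le]; field_simp
    rw [h1, Real.mul_rpow (by positivity) (Real.rpow_nonneg ht.le _), ← Real.rpow_mul ht.le, hc18,
      mul_assoc, ← Real.rpow_add_one ht.ne']
    norm_num
  have hlamt : Tendsto (fun ρ : ℝ =>
      (6 * M ^ 3 / (Real.pi * a ^ 3 * (ρ * Real.sqrt ρ))) ^ ((1 : ℝ) / 18) * Real.sqrt ρ)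
      (𝓝[>] 0) (𝓝 0) :=
    tendsto_zero_of_eq_const_mul_sqrt_rpow c18 (by norm_num) hlam
  -- (4) `ρ wbar = cw (√ρ)^{4/51}`
  have hw : ∀ ρ : ℝ, 0 < ρ →
      ρ * ((Real.pi * 4 / 3) * a ^ 3 *
        (Real.pi * a ^ 3 * (ρ * Real.sqrt ρ) / (6 * M ^ 3)) ^ (-(15 : ℝ) / 17) *
          (2 / ρ) ^ ((2 : ℝ) / 17)) ^ ((2 : ℝ) / 3) = cw * Real.sqrt ρ ^ ((4 : ℝ) / 51) := by
    intro ρ hρ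
    have ht : 0 < Real.sqrt ρ := Real.sqrt_pos.2 hρ
    set t := Real.sqrt ρ with htdef
    have hρt2 : ρ = t ^ (2 : ℝ) := by rw [Real.rpow_two, htdef, Real.sq_sqrt hρ.le]
    have hρt : ρ * t = t ^ (3 : ℝ) := by
      rw [hρt2, show (3 : ℝ) = 2 + 1 by norm_num, Real.rpow_add ht, Real.rpow_one]
    have h1 : Real.pi * a ^ 3 * (ρ * t) / (6 * M ^ 3) = (Real.pi * a ^ 3 / (6 * M ^ 3)) * t ^ (3 : ℝ) := by
      rw [hρt]; ring
    have h2 : (2 : ℝ) / ρ = 2 * t ^ (-(2 : ℝ)) := by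
      rw [hρt2, Real.rpow_neg ht.le, div_eq_mul_inv]
    have hA : 0 ≤ Real.pi * 4 / 3 * a ^ 3 := by positivity
    have hB : 0 < Real.pi * a ^ 3 / (6 * M ^ 3) := by positivity
    rw [h1, h2, Real.mul_rpow hB.le (Real.rpow_nonneg ht.le _), ← Real.rpow_mul ht.le,
      Real.mul_rpow (by norm_num) (Real.rpow_nonneg ht.le _), ← Real.rpow_mul ht.le]
    -- collect the powers of `t`
    have h3 : Real.pi * 4 / 3 * a ^ 3 * ((Real.pi * a ^ 3 / (6 * M ^ 3)) ^ (-(15 : ℝ) / 17) *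
        t ^ ((3 : ℝ) * (-(15 : ℝ) / 17))) * ((2 : ℝ) ^ ((2 : ℝ) / 17) * t ^ (-(2 : ℝ) * ((2 : ℝ) / 17))) =
        (Real.pi * 4 / 3 * a ^ 3 * (Real.pi * a ^ 3 / (6 * M ^ 3)) ^ (-(15 : ℝ) / 17) *
          (2 : ℝ) ^ ((2 : ℝ) / 17)) * t ^ (-(49 : ℝ) / 17) := by
      rw [show (-(49 : ℝ) / 17) = (3 : ℝ) * (-(15 : ℝ) / 17) + (-(2 : ℝ) * ((2 : ℝ) / 17)) by norm_num,
        Real.rpow_add ht]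
      ring
    rw [h3, Real.mul_rpow (by positivity) (Real.rpow_nonneg ht.le _), ← Real.rpow_mul ht.le, ← hcw,
      hρt2, mul_comm, mul_assoc, ← Real.rpow_add ht]
    norm_num
  have hwt : Tendsto (fun ρ : ℝ => ρ * ((Real.pi * 4 / 3) * a ^ 3 *
      (Real.pi * a ^ 3 * (ρ * Real.sqrt ρ) / (6 * M ^ 3)) ^ (-(15 : ℝ) / 17) *
        (2 / ρ) ^ ((2 : ℝ) / 17)) ^ ((2 : ℝ) / 3)) (𝓝[>] 0) (𝓝 0) :=
    tendsto_zero_of_eq_const_mul_sqrt_rpow cw (by norm_num) hw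
  -- (5) the budget sum → 0
  have hsum : Tendsto (fun ρ : ℝ =>
      32 * Real.pi * C₄ * M ^ 2 * a * (Cu * (ρ * a ^ 3) ^ ((1 : ℝ) / 3) + C₁ * Ymax ρ ^ ((1 : ℝ) / 17)) +
        16 * Real.pi * C₄ * a *
          ((6 * M ^ 3 / (Real.pi * a ^ 3 * (ρ * Real.sqrt ρ))) ^ ((1 : ℝ) / 18) * Real.sqrt ρ) / M +
        (6 * M ^ 3 / (Real.pi * a ^ 3 * (ρ * Real.sqrt ρ))) ^ ((1 : ℝ) / 18) * Real.sqrt ρ / M ^ 3 +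
        8 * Real.pi * C₄ * a * (ρ * ((Real.pi * 4 / 3) * a ^ 3 *
          (Real.pi * a ^ 3 * (ρ * Real.sqrt ρ) / (6 * M ^ 3)) ^ (-(15 : ℝ) / 17) *
            (2 / ρ) ^ ((2 : ℝ) / 17)) ^ ((2 : ℝ) / 3))) (𝓝[>] 0) (𝓝 0) := by
    have h1 : Tendsto (fun ρ : ℝ => 32 * Real.pi * C₄ * M ^ 2 * a *
        (Cu * (ρ * a ^ 3) ^ ((1 : ℝ) / 3) + C₁ * Ymax ρ ^ ((1 : ℝ) / 17))) (𝓝[>] 0) (𝓝 0) := by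
      simpa using ((ht3.const_mul Cu).add (hY17.const_mul C₁)).const_mul (32 * Real.pi * C₄ * M ^ 2 * a)
    have h2 : Tendsto (fun ρ : ℝ => 16 * Real.pi * C₄ * a *
        ((6 * M ^ 3 / (Real.pi * a ^ 3 * (ρ * Real.sqrt ρ))) ^ ((1 : ℝ) / 18) * Real.sqrt ρ) / M)
        (𝓝[>] 0) (𝓝 0) := by
      simpa using (hlamt.const_mul (16 * Real.pi * C₄ * a)).div_const M
    have h3 : Tendsto (fun ρ : ℝ =>
        (6 * M ^ 3 / (Real.pi * a ^ 3 * (ρ * Real.sqrt ρ))) ^ ((1 : ℝ) / 18) * Real.sqrt ρ / M ^ 3)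
        (𝓝[>] 0) (𝓝 0) := by
      simpa using hlamt.div_const (M ^ 3)
    have h4 : Tendsto (fun ρ : ℝ => 8 * Real.pi * C₄ * a * (ρ * ((Real.pi * 4 / 3) * a ^ 3 *
        (Real.pi * a ^ 3 * (ρ * Real.sqrt ρ) / (6 * M ^ 3)) ^ (-(15 : ℝ) / 17) *
          (2 / ρ) ^ ((2 : ℝ) / 17)) ^ ((2 : ℝ) / 3))) (𝓝[>] 0) (𝓝 0) := by
      simpa using hwt.const_mul (8 * Real.pi * C₄ * a)
    simpa using ((h1.add h2).add h3).add h4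
  -- extract the threshold
  have e9 := (tendsto_order.1 hsum).2 ε hε
  refine exists_pos_forall_of_eventually ?_
  filter_upwards [e9] with ρ h9
  simp only [hYmax] at h9
  exact Eq.trans_le (by ring) h9.le

end Dilute


/-! ## The sharp mesoscopic floor, pinned -/

section Final

/-- **The interacting case of the pinned mesoscopic floor, sharp form.**  For a repulsive
finite-range `v` with positive scattering length, every `η > 0` and every `M > 0` there is
`ρ₀ = ρ₀(η, M, v) > 0` such that for `0 < ρ < ρ₀`, at the scale `ℓ = M/√ρ`, eventually in `N`,
every `1`-near-minimiser of the Dirichlet energy in the box of side `L = (N/ρ)^{1/3}` has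
`∑_q ⟨u_q, γ_Ψ u_q⟩ ≥ (1-η)N` at every dyadic level `k` with `ℓ ≤ L/2^k < 2ℓ`: LSSY's Lemma 5.2 in
every well-occupied cell of side `s = L/2^k`, Lemma 4.1 on every sub-cell slice, the cell method
with a crowding penalty (`occupation_bookkeeping`), the Dyson upper bound
(`eventually_groundStateEnergy_le_dyson`), and the budget-`ηN` form
`sub_le_sum_occupation_of_budget` of the deterministic floor inequality; the budget is `≤ ηN` for
`ρ < ρ₀(η, M, v)` by `floorBudgetSum_eventually_le` (`floor_of_scatteringLength_pos` is the case
`η = 1/8`). [folklore] -/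
theorem floor_of_scatteringLength_pos_sharp {v : ℝ → ℝ≥0∞} (hv : IsRepulsiveFiniteRange v)
    (hapos : 0 < scatteringLength v) {η : ℝ} (hη : 0 < η) {M : ℝ} (hM : 0 < M) :
    ∃ ρ₀ : ℝ, 0 < ρ₀ ∧ ∀ ρ : ℝ, 0 < ρ → ρ < ρ₀ →
      ∀ᶠ N : ℕ in atTop, ∀ Ψ : TrialState N (sideLength ρ N),
        energy v Ψ ≤ groundStateEnergy v N (sideLength ρ N) + 1 →
        ∀ k : ℕ, M / Real.sqrt ρ ≤ sideLength ρ N / 2 ^ k →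
          sideLength ρ N / 2 ^ k < 2 * (M / Real.sqrt ρ) →
            ENNReal.ofReal ((1 - η) * N) ≤
              ∑ q : SubIdx (2 ^ k), occupation N (subMode (sideLength ρ N / 2 ^ k) q) Ψ.ψ := by
  obtain ⟨R₀, hR₀⟩ := hv.2
  have hfin : scatteringLength v ≠ ⊤ := scatteringLength_ne_top_of_finiteRange hR₀
  set a : ℝ := (scatteringLength v).toReal with ha_def
  have ha : 0 < a := ENNReal.toReal_pos hapos.ne' hfin
  obtain ⟨δ₁, C₁, hδ₁, hC₁, Hloc⟩ := locLowerBound_neumann v hv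
  obtain ⟨δ₂, C₂, C₂', hδ₂, hC₂, hC₂', HLY⟩ := LSSY2005_lowerBound_neumann_holds v hv hfin
  obtain ⟨C₄, hC₄, H41⟩ := LSSY2005_lemma41_holds
  obtain ⟨Cu, ρu, hCu, hρu, Hup⟩ := eventually_groundStateEnergy_le_dyson hR₀ hv.1 hfin hapos
  obtain ⟨ρp, hρp, Hpar⟩ := floorParams_eventually (C₁ := C₁) (C₂ := C₂) (C₂' := C₂') (C₄ := C₄)
    (Cu := Cu) ha hM hδ₁ hδ₂
  obtain ⟨ρb, hρb, Hbud⟩ := floorBudgetSum_eventually_le (C₁ := C₁) (C₄ := C₄) (Cu := Cu) ha hM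
    (half_pos hη)
  refine ⟨min (min ρp ρu) ρb, lt_min (lt_min hρp hρu) hρb, fun ρ hρ hρlt => ?_⟩
  have hρp' : ρ < ρp := lt_of_lt_of_le hρlt ((min_le_left _ _).trans (min_le_left _ _))
  have hρu' : ρ < ρu := lt_of_lt_of_le hρlt ((min_le_left _ _).trans (min_le_right _ _))
  have hρb' : ρ < ρb := lt_of_lt_of_le hρlt (min_le_right _ _)
  obtain ⟨hρ1, hYδ₁, hYδ₂, hy12, hθ12, hC2y, hbox, hpen, ht1, -⟩ := Hpar ρ hρ hρp'
  have hbud := Hbud ρ hρ hρb'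
  have hsr : 0 < Real.sqrt ρ := Real.sqrt_pos.2 hρ
  obtain ⟨hmth1, hmth2, hmth3⟩ := ceil_inv_bounds hρ hρ1
  set mth : ℕ := ⌈ρ⁻¹⌉₊ with hmth_def
  have hmthr : (0 : ℝ) < mth := by exact_mod_cast hmth3
  -- density-only quantities
  set Ymax : ℝ := 8 * Real.pi * a ^ 3 * Real.sqrt ρ / (3 * M ^ 3) with hYmax
  set θ : ℝ := C₁ * Ymax ^ ((1 : ℝ) / 17) with hθ_def
  have hθ0 : 0 ≤ θ := by positivity
  set lambar : ℝ := (6 * M ^ 3 / (Real.pi * a ^ 3 * (ρ * Real.sqrt ρ))) ^ ((1 : ℝ) / 18) with hlambar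
  set wbar : ℝ := ((Real.pi * 4 / 3) * a ^ 3 *
    (Real.pi * a ^ 3 * (ρ * Real.sqrt ρ) / (6 * M ^ 3)) ^ (-(15 : ℝ) / 17) *
      (2 / ρ) ^ ((2 : ℝ) / 17)) ^ ((2 : ℝ) / 3) with hwbar
  -- thresholds in `N`
  filter_upwards [Hup ρ hρ hρu',
    tendsto_natCast_atTop_atTop.eventually_ge_atTop (2 * (8 * C₄ * M ^ 2 / ρ + C₄ * wbar) / η),
    eventually_gt_atTop 0] with N hUp hN1 hNpos Ψ hΨ k hk1 hk2
  obtain ⟨n, rfl⟩ : ∃ n, N = n + 1 := ⟨N - 1, by omega⟩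
  -- the scale
  set s : ℝ := sideLength ρ (n + 1) / 2 ^ k with hs_def
  have hs : 0 < s := lt_of_lt_of_le (by positivity) hk1
  have hsl : M / Real.sqrt ρ ≤ s := hk1
  have hsu : s ≤ 2 * M / Real.sqrt ρ := by rw [mul_div_assoc]; exact hk2.le
  have hL : 0 < sideLength ρ (n + 1) := sideLength_pos_of_pos hρ (Nat.succ_pos n)
  have hK : 0 < 2 ^ k := pow_pos two_pos k
  have hKs : ((2 ^ k : ℕ) : ℝ) * s = sideLength ρ (n + 1) := by
    rw [hs_def]; push_cast; field_simp
  have hKc : (0 : ℝ) < (((2 ^ k) ^ 3 : ℕ) : ℝ) := by positivity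
  have hKN : (((n + 1 : ℕ) : ℝ)) / (((2 ^ k) ^ 3 : ℕ) : ℝ) = ρ * s ^ 3 := by
    have h3 := sideLength_pow_three hρ (n + 1)
    rw [← hKs] at h3
    push_cast at h3
    rw [div_eq_iff hKc.ne']
    push_cast
    field_simp at h3
    linarith [h3]
  -- cell quantities
  set Yc : ℕ → ℝ := fun m => 4 * Real.pi * ((m : ℝ) / s ^ 3) * a ^ 3 / 3 with hYc
  have hYc0 : ∀ m, 0 ≤ Yc m := fun m => by rw [hYc]; positivity
  set good : ℕ → Prop := fun m => Yc m ^ (-(1 : ℝ) / 17) ≤ m ∧ (m : ℝ) ≤ mth with hgood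
  set yf : ℕ → ℝ := fun m => Yc m ^ ((1 : ℝ) / 17) with hyf
  set Rf : ℕ → ℝ := fun m => a * Yc m ^ (-(5 : ℝ) / 17) with hRf
  set LYval : ℝ := 4 * Real.pi * ((mth : ℝ) / s ^ 3) * a * (1 - C₂ * Yc mth ^ ((1 : ℝ) / 17)) * mth
    with hLYval
  set lb : ℕ → ℝ := fun m => if good m then 4 * Real.pi * ((m : ℝ) / s ^ 3) * a * (1 - C₁ * yf m) * m
    else if (m : ℝ) ≤ mth then 0 else ((m / mth : ℕ) : ℝ) * LYval with hlb
  set lam : ℝ := (3 * s ^ 3 / (4 * Real.pi * a ^ 3)) ^ ((1 : ℝ) / 18) with hlam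
  set w : ℝ := ((Real.pi * 4 / 3) * a ^ 3 * (4 * Real.pi * a ^ 3 / (3 * s ^ 3)) ^ (-(15 : ℝ) / 17) *
    (mth : ℝ) ^ ((2 : ℝ) / 17)) ^ ((2 : ℝ) / 3) with hw_def
  set κ : ℝ := 1 / (2 * C₄ * s ^ 2) with hκ_def
  set Ur : ℝ := 4 * Real.pi * ρ * a * (1 + Cu * (ρ * a ^ 3) ^ ((1 : ℝ) / 3)) * ((n : ℝ) + 1) + 1
    with hUr
  set A : ℝ := (1 - θ) * (4 * Real.pi * a / s ^ 3) * (((n + 1 : ℕ) : ℝ)) ^ 2 / (((2 ^ k) ^ 3 : ℕ) : ℝ)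
    with hA_def
  set B : ℝ := (((2 ^ k) ^ 3 : ℕ) : ℝ) * lam *
    ((1 - θ) * (8 * Real.pi * a / s ^ 3) * ((((n + 1 : ℕ) : ℝ)) / (((2 ^ k) ^ 3 : ℕ) : ℝ)) + κ) with hB_def
  -- density bounds for good cells and at the threshold
  have hYmax_bd : ∀ m : ℕ, (m : ℝ) ≤ mth → Yc m ≤ Ymax := fun m hm =>
    cellY_le_Ymax ha hM hρ hsl hm hmth2
  have hYmin_bd : Real.pi * a ^ 3 * Real.sqrt ρ / (6 * M ^ 3) ≤ Yc mth :=
    Ymin_le_cellY ha hM hρ hsu hs hmth1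
  have hθm : ∀ m : ℕ, (m : ℝ) ≤ mth → C₁ * yf m ≤ θ := fun m hm => by
    rw [hyf, hθ_def]
    exact mul_le_mul_of_nonneg_left (Real.rpow_le_rpow (hYc0 m) (hYmax_bd m hm) (by norm_num)) hC₁.le
  have hθ1 : θ ≤ 1 / 2 := hθ12
  have hC2m : C₂ * Yc mth ^ ((1 : ℝ) / 17) ≤ 1 / 2 :=
    le_trans (mul_le_mul_of_nonneg_left (Real.rpow_le_rpow (hYc0 mth) (hYmax_bd mth le_rfl)
      (by norm_num)) hC₂.le) hC2y
  have hLYval : 2 * Real.pi * a * (mth : ℝ) ^ 2 / s ^ 3 ≤ LYval := by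
    rw [hLYval]
    have h1 : (1 : ℝ) / 2 ≤ 1 - C₂ * Yc mth ^ ((1 : ℝ) / 17) := by linarith
    calc 2 * Real.pi * a * (mth : ℝ) ^ 2 / s ^ 3
        = 4 * Real.pi * ((mth : ℝ) / s ^ 3) * a * (1 / 2) * mth := by field_simp; ring
      _ ≤ 4 * Real.pi * ((mth : ℝ) / s ^ 3) * a * (1 - C₂ * Yc mth ^ ((1 : ℝ) / 17)) * mth := by
          gcongr
  have hLYval0 : 0 ≤ LYval := le_trans (by positivity) hLYval
  ----------------------------------------------------------------
  -- the hypotheses of the deterministic floor inequality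
  ----------------------------------------------------------------
  have hW : ∀ m' : ℕ, good (m' + 1) →
      ((m' : ℝ≥0∞) * (ENNReal.ofReal (Rf (m' + 1)) ^ 3 * ENNReal.ofReal (Real.pi * 4 / 3))) ^
        (2 / 3 : ℝ) ≤ ENNReal.ofReal w := by
    intro m' hg
    have hm : (m' : ℝ) + 1 ≤ mth := by have := hg.2; push_cast at this; exact this
    have h := excludedVolume_rpow_le (s := s) ha hs hm
    rw [hw_def, hRf]
    exact h
  have hy : ∀ m, good m → 0 ≤ yf m ∧ yf m ≤ 1 / 2 := by
    intro m hg
    refine ⟨Real.rpow_nonneg (hYc0 m) _, ?_⟩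
    exact le_trans (Real.rpow_le_rpow (hYc0 m) (hYmax_bd m hg.2) (by norm_num)) hy12
  have hloc : ∀ m, good m → ENNReal.ofReal (lb m) ≤ locGroundStateEnergy (yf m) (Rf m) v m s := by
    intro m hg
    have hlbm : lb m = 4 * Real.pi * ((m : ℝ) / s ^ 3) * a * (1 - C₁ * yf m) * m := by
      rw [hlb]; simp only [hg, if_true]
    rw [hlbm]
    rcases Nat.eq_zero_or_pos m with rfl | hmpos
    · simp
    have hY1 : Yc m < δ₁ := lt_of_le_of_lt (hYmax_bd m hg.2) hYδ₁
    have hY2 : Yc m ^ (-(6 : ℝ) / 17) < s / a := rpow_lt_div_of_le hmpos hs ha hg.1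
    exact Hloc m s hs hY1 hY2
  have hE0 : ∀ m, ¬ good m → ENNReal.ofReal (lb m) ≤ neumannGroundStateEnergy v m s := by
    intro m hg
    by_cases hm : (m : ℝ) ≤ mth
    · have : lb m = 0 := by rw [hlb]; simp only [hg, if_false, hm, if_true]
      rw [this, ENNReal.ofReal_zero]; exact bot_le
    · have hlbm : lb m = ((m / mth : ℕ) : ℝ) * LYval := by
        rw [hlb]; simp only [hg, if_false, hm]
      rw [hlbm, ENNReal.ofReal_mul (Nat.cast_nonneg _), ENNReal.ofReal_natCast]
      -- the Lieb–Yngvason bound in the cell at the threshold occupation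
      have hY1 : Yc mth < δ₂ := lt_of_le_of_lt (hYmax_bd mth le_rfl) hYδ₂
      have hY2 : C₂' * Yc mth ^ (-(6 : ℝ) / 17) < s / a := by
        have h1 : Yc mth ^ (-(6 : ℝ) / 17) ≤
            (Real.pi * a ^ 3 * Real.sqrt ρ / (6 * M ^ 3)) ^ (-(6 : ℝ) / 17) :=
          Real.rpow_le_rpow_of_nonpos (by positivity) hYmin_bd (by norm_num)
        have h2 : M / (a * Real.sqrt ρ) ≤ s / a := by
          rw [div_le_div_iff₀ (by positivity) ha]
          have h3 : M ≤ s * Real.sqrt ρ := (div_le_iff₀ hsr).1 hsl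
          calc M * a ≤ s * Real.sqrt ρ * a := by gcongr
            _ = s * (a * Real.sqrt ρ) := by ring
        exact lt_of_le_of_lt (mul_le_mul_of_nonneg_left h1 hC₂'.le) (hbox.trans_le h2)
      have hLY : ENNReal.ofReal LYval ≤ neumannGroundStateEnergy v mth s := HLY mth s hs hY1 hY2
      have hsup := LSSY2005_superadditivity_holds.mul_le hv.1 hs mth (m / mth) (m % mth)
      rw [Nat.div_add_mod'] at hsup
      exact le_trans (mul_le_mul_right hLY _) hsup
  -- the occupation bookkeeping
  have hκcond : κ + (1 - θ) * (8 * Real.pi * a / s ^ 3) *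
      ((((n + 1 : ℕ) : ℝ)) / (((2 ^ k) ^ 3 : ℕ) : ℝ)) ≤ Real.pi * a * mth / s ^ 3 := by
    rw [hKN, hκ_def]
    exact kappa_condition ha hM hρ hC₄ hsl hsu hθ0 hmth1 hpen
  have hcomb : ∀ nv : Fin ((2 ^ k) ^ 3) → ℕ, ∑ c, nv c = n + 1 →
      ENNReal.ofReal A + ENNReal.ofReal κ * ∑ c, (if good (nv c) then 0 else (nv c : ℝ≥0∞)) ≤
        (∑ c, ENNReal.ofReal (lb (nv c))) + ENNReal.ofReal B := by
    intro nv hsum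
    rw [hA_def, hB_def]
    refine occupation_bookkeeping (mth := mth) good lb (lam := lam) (κh := Real.pi * a * mth / s ^ 3) hs ha.le
      (by linarith) (by positivity) (by positivity) ?_ ?_ ?_ hκcond nv hsum
    · -- good cells
      intro m hg
      have hlbm : lb m = 4 * Real.pi * ((m : ℝ) / s ^ 3) * a * (1 - C₁ * yf m) * m := by
        rw [hlb]; simp only [hg, if_true]
      rw [hlbm]
      have h1 : C₁ * yf m ≤ θ := hθm m hg.2
      have h2 : 0 ≤ 4 * Real.pi * a / s ^ 3 * (m : ℝ) ^ 2 := by positivity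
      calc (1 - θ) * (4 * Real.pi * a / s ^ 3) * (m : ℝ) ^ 2
          = (1 - θ) * (4 * Real.pi * a / s ^ 3 * (m : ℝ) ^ 2) := by ring
        _ ≤ (1 - C₁ * yf m) * (4 * Real.pi * a / s ^ 3 * (m : ℝ) ^ 2) :=
            mul_le_mul_of_nonneg_right (by linarith) h2
        _ = _ := by ring
    · -- low cells
      intro m hg hm
      have hlbm : lb m = 0 := by rw [hlb]; simp only [hg, if_false, hm, if_true]
      refine ⟨hlbm.ge, ?_⟩
      have hng : ¬ (Yc m ^ (-(1 : ℝ) / 17) ≤ m) := fun h => hg ⟨h, hm⟩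
      exact (lt_lam_of_not_rpow_le ha hs hng).2.le
    · -- high cells
      intro m hg hm
      have hm' : ¬ ((m : ℝ) ≤ mth) := not_le.2 hm
      have hlbm : lb m = ((m / mth : ℕ) : ℝ) * LYval := by rw [hlb]; simp only [hg, if_false, hm']
      rw [hlbm]
      have hmn : mth < m := by exact_mod_cast hm
      have hq := div_two_mul_le_nat_div hmth3 hmn
      calc Real.pi * a * mth / s ^ 3 * m = (m : ℝ) / (2 * mth) * (2 * Real.pi * a * (mth : ℝ) ^ 2 / s ^ 3) := by
            field_simp
        _ ≤ ((m / mth : ℕ) : ℝ) * LYval := mul_le_mul hq hLYval (by positivity) (Nat.cast_nonneg _)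
  have hκ1 : 1 ≤ 2 * C₄ * s ^ 2 * κ := by
    rw [hκ_def, show 2 * C₄ * s ^ 2 * (1 / (2 * C₄ * s ^ 2)) = 1 by field_simp]
  have hE : energy v Ψ ≤ ENNReal.ofReal Ur := by
    refine hΨ.trans ?_
    rw [hUr, ENNReal.ofReal_add (by positivity) zero_le_one, ENNReal.ofReal_one]
    rw [← ha_def] at hUp
    refine add_le_add (hUp.trans (le_of_eq ?_)) le_rfl
    norm_num
  have hA_eq : A = (1 - θ) * 4 * Real.pi * a * ρ * ((n : ℝ) + 1) := by
    rw [hA_def]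
    have h1 : (((n + 1 : ℕ) : ℝ)) ^ 2 / (((2 ^ k) ^ 3 : ℕ) : ℝ) =
        ((n + 1 : ℕ) : ℝ) * ((((n + 1 : ℕ) : ℝ)) / (((2 ^ k) ^ 3 : ℕ) : ℝ)) := by
      rw [pow_two, mul_div_assoc]
    rw [mul_div_assoc, h1, hKN]
    push_cast
    field_simp
  have hlam0 : 0 ≤ lam := by rw [hlam]; positivity
  have hB0 : 0 ≤ B := by
    rw [hB_def]
    exact mul_nonneg (mul_nonneg (Nat.cast_nonneg _) hlam0) (add_nonneg (mul_nonneg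
      (mul_nonneg (by linarith) (by positivity)) (by positivity)) (by rw [hκ_def]; positivity))
  have hUBA : A ≤ Ur + B := by
    have hP : 0 ≤ 4 * Real.pi * ρ * a * ((n : ℝ) + 1) := by positivity
    have ht0 : 0 ≤ Cu * (ρ * a ^ 3) ^ ((1 : ℝ) / 3) := by positivity
    calc A = (1 - θ) * (4 * Real.pi * ρ * a * ((n : ℝ) + 1)) := by rw [hA_eq]; ring
      _ ≤ (1 + Cu * (ρ * a ^ 3) ^ ((1 : ℝ) / 3)) * (4 * Real.pi * ρ * a * ((n : ℝ) + 1)) :=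
          mul_le_mul_of_nonneg_right (by linarith) hP
      _ ≤ Ur := by rw [hUr]; linarith
      _ ≤ Ur + B := le_add_of_nonneg_right hB0
  have hbudget : 2 * C₄ * s ^ 2 * (Ur + B - A) + C₄ * w * Ur ≤ η * ((n : ℝ) + 1) := by
    have hlamle : lam ≤ lambar := lam_le_lambar ha hM hρ hsu hs
    have hwle : w ≤ wbar := w_le_wbar ha hM hρ hsu hs hmthr hmth2
    have hw0 : 0 ≤ w := by rw [hw_def]; positivity
    have hKN' : ((n : ℝ) + 1) / (((2 ^ k) ^ 3 : ℕ) : ℝ) = ρ * s ^ 3 := by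
      rw [← hKN]; push_cast; rfl
    have hN1' : 2 * (8 * C₄ * M ^ 2 / ρ + C₄ * wbar) ≤ η * ((n : ℝ) + 1) := by
      rw [div_le_iff₀' hη] at hN1; push_cast at hN1; exact hN1
    have h := floorBudget_le_of_le (lam := lam) (w := w) (N := (n : ℝ) + 1)
      (K := (((2 ^ k) ^ 3 : ℕ) : ℝ)) hM ha hC₄ hCu.le hρ hsl hsu hθ0 le_rfl (by positivity) hlamle
      hw0 hwle (by positivity) hKc hKN' ht1 hbud hN1'
    rw [hUr, hB_def, hA_def]
    push_cast at h ⊢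
    exact h
  ----------------------------------------------------------------
  -- the deterministic floor inequality
  ----------------------------------------------------------------
  have hw0 : 0 ≤ w := by rw [hw_def]; positivity
  have hUr0 : 0 ≤ Ur := by rw [hUr]; positivity
  have hA0 : 0 ≤ A := by
    rw [hA_eq]
    have : 0 ≤ 1 - θ := by linarith
    positivity
  have hmain := sub_le_sum_occupation_of_budget hs hK hKs hL hv.1 Ψ good Rf yf lb hC₄.le hw0 hUr0
    hA0 hB0 hη.le H41 hW hy hloc hE0 hcomb hκ1 hE hUBA hbudget
  push_cast
  exact hmain

end Final

end Literature.MathematicalPhysics.QuantumManyBody.BoseGas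

end
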